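import Literature.Barriers.NavierStokesRegularity.AxisymmetricTypeIExclusion
import Literature.Analysis.FluidPDE.SereginSverakAxisymmetric
import Literature.Analysis.FluidPDE.SereginSverakAxisymmetricProofs
import Literature.Analysis.FluidPDE.SereginSverakBlowup
import Literature.Analysis.FluidPDE.SereginSverakScaledEnergyHolds
import Literature.Analysis.FluidPDE.SereginSverakInteriorContinuity
import Literature.Analysis.FluidPDE.NSBoundedInteriorRegularityProofs
import Literature.Analysis.FluidPDE.SereginSverakBlowupCompactnessProofs
import HarnessLib

/-!
# Barrier `AxisymmetricTypeIExclusion`: reduction to the printed architecture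

Companion of `Literature/Barriers/NavierStokesRegularity/AxisymmetricTypeIExclusion.lean`. The
barrier fact `AxisymmetricTypeIExclusion` (Seregin–Šverák 2009, Thm. 3.1 = Thm. 1.1,
arXiv:0804.1803) is an XL named fact: its printed proof rests on the Caffarelli–Kohn–Nirenberg
partial regularity theory, a De Giorgi–Moser iteration (App. II), Seregin's local energy
bootstrap, the local `L_p` theory of the Stokes system and the Liouville theorem of
Koch–Nadirashvili–Seregin–Šverák (2009). This file PROVES the top of that architecture: the
barrier follows from the four named facts

* `Literature.Analysis.FluidPDE.SereginSverak2009.ScaledEnergyBound` (SS 2009, Lemma 3.5),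
* `Literature.Analysis.FluidPDE.SereginSverak2009.AxisDecayBound` (SS 2009, Prop. 3.7),
* `Literature.Analysis.FluidPDE.SereginSverak2009.BlowupAlternative` (SS 2009, §4, the blow-up
  step),
* `Literature.Analysis.FluidPDE.KNSS2009_liouville_bound_C_over_r` (KNSS 2009, Thm. 5.3),

exactly as §4 of the paper assembles them
(`Literature.Analysis.FluidPDE.SereginSverak2009.isRegularAtOrigin_of_typeI`); what is proved
here is the dictionary between the barrier's phrasing (`ssCylinder`, conclusion on the ball
cylinders `Q_r(0,0) = ]-r², 0[ × B_r` of `parabolicCylinder`) and the notation of SS 2009, §3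
(`SereginSverak2009.parCyl`, regularity at the origin on the cylinders `Q(r) = 𝒞(r) × ]-r², 0[`):
`ssCylinder = Q(0, 1)` and `Q_r(0, 0) ⊆ Q(r)`.

## The corrected blow-up step (second reduction)

`SereginSverakBlowup.lean` (module docstring) observes that step (iv) of §4 consumes the
functionals at the moving blow-up centres `(x_{3k} e₃, t_k)`, which the origin-centred (p1) of
`BlowupAlternative` does not control: `BlowupAlternative` is true, but its discharge amounts to
Thm. 3.2 of the paper. Under the Type I bound the printed range of Lemma 3.5 suffices, which is
the corrected fact `SereginSverak2009.BlowupAlternativeTypeI` with the assembly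
`SereginSverak2009.isRegularAtOrigin_of_typeI'`. The second half of this file reduces the
barrier along that corrected route (`axisymmetricTypeIExclusion_of_blowupAlternativeTypeI`)
and, using the proved reduction of Prop. 3.7 to Lemma 3.5 and the off-axis bound of
Seregin–Zajaczkowski 2007 (`SereginSverak2009.axisDecayBound_of_offAxisBound`,
`SereginSverakAxisymmetricProofs.lean`), down to the current leaves of the DAG
(`axisymmetricTypeIExclusion_of_leaves`): `ScaledEnergyBound` (SS Lemma 3.5), `OffAxisBound`
(SS p. 10 after (as15) = Seregin–Zajaczkowski 2007, Prop. 4.1), `BlowupAlternativeTypeI`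
(SS §4) and `KNSS2009_liouville_bound_C_over_r` (KNSS Thm. 5.3).

## Frontier of the discharge (third reduction, 2026-08-15)

Two of the four hypotheses of `axisymmetricTypeIExclusion_of_leaves` have since moved: Lemma 3.5
is a theorem (`SereginSverak2009.ScaledEnergyBound_holds`, `SereginSverakScaledEnergyHolds.lean`:
(as6) `GradientEnergyBound_holds`, (as11) `CubicAbsorption_holds`, (as12)
`LocalEnergyEstimate_holds`, (as13) `PressureDecay_holds`, iterated by
`ScaledEnergyBound.of_inputs`), and the interior-continuity input of the blow-up step is a
theorem (`SereginSverak2009.InteriorContinuity_holds`, `SereginSverakInteriorContinuityHolds.lean`,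
= `interiorContinuity_of NSBoundedInteriorContinuity_holds`, which is the form used below), so
that `BlowupAlternativeTypeI` follows from the uniform local Hölder bound `LocalHolderBound` of
(p12)ff alone (`blowupAlternativeTypeI_of_localHolderBound`,
`SereginSverakBlowupCompactnessProofs.lean`; named form
`blowupAlternativeTypeI_of_localHolderBound'` in `SereginSverakInteriorContinuityHolds.lean`).
The last theorem of this file,
`axisymmetricTypeIExclusion_of_offAxisBound_of_localHolderBound`, records the barrier from the
three named facts that remain: `OffAxisBound` (the display after (as15), p. 10 =
Seregin–Zajaczkowski 2007, Prop. 4.1 rescaled; in-tree reductions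
`offAxisBound_of_lemma61 : OffAxisL6Bound → seregin2014_lemma61 → OffAxisBound`,
`SereginSverakOffAxisAssembly.lean`, and `offAxisBound_of_offAxisSupBound_of_higherRegularity`,
`SereginSverakOffAxisInputsProofs.lean`), `LocalHolderBound` (in-tree reduction
`localHolderBound_of : HeatDivSourceGradientBound → StokesLocalIntegrabilityGain →
StokesLocalHolderBound → LocalHolderBound`, `SereginSverakLocalHolderProofs.lean`, the [LSU]/[S8]
estimates of `SereginLocalStokesRegularity.lean`) and KNSS 2009, Thm. 5.3 (in-tree reduction
`KNSS2009_liouville_bound_C_over_r_of_facts`, `KNSSSwirlLiouville.lean`, whose middle input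
`KNSS2009_swirl_sup_nonpos` is proved in `KNSSThm53Discharge.lean`). The unconditional
`AxisymmetricTypeIExclusion_holds` is this theorem applied to `OffAxisBound_holds`,
`LocalHolderBound_holds` and `KNSS2009_liouville_bound_C_over_r_holds` once those exist.

## References

* G. Seregin, V. Šverák, Comm. PDE 34 (2009), 171–201, arXiv:0804.1803, §3 (p. 9), Thm. 3.1,
  Lemma 3.5, Prop. 3.7, §4 (p. 11). [`SereginSverak2009`]
* G. Koch, N. Nadirashvili, G. Seregin, V. Šverák, Acta Math. 203 (2009), 83–105, Thm. 5.3.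
  [`KochNadirashviliSereginSverak2009`]
-/

noncomputable section

open MeasureTheory Set Function TopologicalSpace
open scoped ENNReal NNReal

namespace Literature.Barriers.NavierStokesRegularity

open Literature.Analysis.FluidPDE Literature.Analysis.FluidPDE.SereginSverak2009

/-! ### Dictionary between the barrier's cylinders and those of SS 2009, §3 -/

/-- The barrier's unit cylinder is the unit cylinder `Q = Q(0, 1) = 𝒞 × ]-1, 0[` of
Seregin–Šverák 2009, §3. [cite: SereginSverak2009, §3 (arXiv p. 9)] -/
theorem ssCylinder_eq_parCyl : ssCylinder = parCyl 0 1 := by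
  ext z
  simp [mem_ssCylinder]

/-- The same identity in `Opens (ℝ × ℝ³)`. [cite: SereginSverak2009, §3 (arXiv p. 9)] -/
theorem ssCylinderOpens_eq_parCylOpens : ssCylinderOpens = parCylOpens 0 1 :=
  Opens.ext ssCylinder_eq_parCyl

/-- `|x₃| ≤ |x|`. [folklore] -/
theorem abs_apply_two_le_norm (x : EuclideanSpace ℝ (Fin 3)) : |x 2| ≤ ‖x‖ := by
  simpa only [Real.norm_eq_abs] using PiLp.norm_apply_le x 2

/-- The ball cylinders about the origin sit inside the SS cylinders of the same radius:
`Q_r(0, 0) = ]-r², 0[ × B_r ⊆ 𝒞(r) × ]-r², 0[ = Q(r)` (`B_r ⊆ 𝒞(r)` as `|x'|, |x₃| ≤ |x|`;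
`|x'| ≤ |x|` is `SereginSverak2009.cylRadius_le_norm'`). [folklore] -/
theorem parabolicCylinder_zero_subset_parCyl (r : ℝ) :
    parabolicCylinder r ((0 : ℝ), (0 : EuclideanSpace ℝ (Fin 3))) ⊆ parCyl 0 r := by
  intro z hz
  rw [mem_parabolicCylinder] at hz
  obtain ⟨⟨h1, h2⟩, h3⟩ := hz
  rw [dist_zero_right] at h3
  refine mem_parCyl_zero.2 ⟨⟨by simpa using h1, h2⟩, (cylRadius_le_norm' z.2).trans_lt h3,
    (abs_apply_two_le_norm z.2).trans_lt h3⟩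

/-- Regularity of the origin in the sense of SS 2009, §3 (`u ∈ L^∞(Q(r))` for some `r > 0`)
gives the barrier's conclusion (`u ∈ L^∞(Q_r(0,0))` for some `r > 0`), by `Q_r(0,0) ⊆ Q(r)`.
[cite: SereginSverak2009, §3 (definition of regular point, arXiv p. 9)] -/
theorem exists_eLpNorm_parabolicCylinder_lt_top_of_isRegularAtOrigin
    {u : ℝ → EuclideanSpace ℝ (Fin 3) → EuclideanSpace ℝ (Fin 3)} (h : IsRegularAtOrigin u) :
    ∃ r > 0, eLpNorm (uncurry u) ∞
      (volume.restrict (parabolicCylinder r ((0 : ℝ), (0 : EuclideanSpace ℝ (Fin 3))))) < ∞ := by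
  obtain ⟨r, hr, hfin⟩ := h
  exact ⟨r, hr, lt_of_le_of_lt (eLpNorm_mono_measure _
    (Measure.restrict_mono (parabolicCylinder_zero_subset_parCyl r) le_rfl)) hfin⟩

/-! ### The barrier from the named facts -/

/-- **`AxisymmetricTypeIExclusion` from the printed architecture.** Seregin–Šverák 2009,
Thm. 3.1 (= Thm. 1.1), in the barrier's phrasing, follows from Lemma 3.5 (`ScaledEnergyBound`),
Prop. 3.7 (`AxisDecayBound`), the blow-up step of §4 (`BlowupAlternative`) and KNSS 2009,
Thm. 5.3 (`KNSS2009_liouville_bound_C_over_r`), through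
`SereginSverak2009.isRegularAtOrigin_of_typeI` and the dictionary above. Discharging these four
named facts discharges the barrier. [cite: SereginSverak2009, Thm. 3.1 and §4] -/
theorem axisymmetricTypeIExclusion_of_facts (h35 : ScaledEnergyBound) (h37 : AxisDecayBound)
    (h4 : BlowupAlternative) (h53 : KNSS2009_liouville_bound_C_over_r) :
    AxisymmetricTypeIExclusion := by
  intro u p hsol hu3 hp haxi hI
  rw [ssCylinderOpens_eq_parCylOpens] at hsol
  rw [ssCylinder_eq_parCyl] at hu3 hp hI
  have hloc : IsAxisymmetricLocalSolution u p := ⟨hsol, hu3, hp, haxi⟩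
  exact exists_eLpNorm_parabolicCylinder_lt_top_of_isRegularAtOrigin
    (isRegularAtOrigin_of_typeI h35 h37 h4 h53 hloc hI)

/-- The same reduction for the non-existence form
`AxisymmetricTypeIExclusion.no_typeI_singularity` (KNSS 2009, §1: axisymmetric singularities
are of Type II): under the four named facts there is no axisymmetric distributional solution in
the unit cylinder with the Type I bound and a singular origin. [cite: SereginSverak2009, Thm. 3.1 and §4] -/
theorem no_typeI_singularity_of_facts (h35 : ScaledEnergyBound) (h37 : AxisDecayBound)
    (h4 : BlowupAlternative) (h53 : KNSS2009_liouville_bound_C_over_r) :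
    ¬ ∃ (u : ℝ → EuclideanSpace ℝ (Fin 3) → EuclideanSpace ℝ (Fin 3))
        (p : ℝ → EuclideanSpace ℝ (Fin 3) → ℝ),
      IsDistributionalNSSolutionOn ssCylinderOpens 1 0 u p ∧
      (∫⁻ z in ssCylinder, ‖u z.1 z.2‖ₑ ^ (3 : ℕ) < ∞) ∧
      (∫⁻ z in ssCylinder, ‖p z.1 z.2‖ₑ ^ (3 / 2 : ℝ) < ∞) ∧
      (∀ t ∈ Ioo (-1 : ℝ) 0, IsAxisymmetric (u t)) ∧
      (∃ C : ℝ, ∀ᵐ z ∂(volume.restrict ssCylinder), Real.sqrt (-z.1) * ‖u z.1 z.2‖ ≤ C) ∧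
      ∀ r > 0, eLpNorm (uncurry u) ∞ (volume.restrict (parabolicCylinder r (0, 0))) = ∞ :=
  (axisymmetricTypeIExclusion_of_facts h35 h37 h4 h53).no_typeI_singularity

/-! ### The barrier along the corrected blow-up step, and from the current leaves -/

/-- **`AxisymmetricTypeIExclusion` from the corrected blow-up alternative.** Seregin–Šverák
2009, Thm. 3.1 in the barrier's phrasing, from Lemma 3.5 (`ScaledEnergyBound`), Prop. 3.7
(`AxisDecayBound`), the Type I blow-up step of §4 (`BlowupAlternativeTypeI`, whose hypotheses
carry the full printed output of Lemma 3.5 and so control the moving blow-up centres) and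
KNSS 2009, Thm. 5.3, through `SereginSverak2009.isRegularAtOrigin_of_typeI'`.
[cite: SereginSverak2009, Thm. 3.1 and §4] -/
theorem axisymmetricTypeIExclusion_of_blowupAlternativeTypeI (h35 : ScaledEnergyBound)
    (h37 : AxisDecayBound) (h4 : BlowupAlternativeTypeI)
    (h53 : KNSS2009_liouville_bound_C_over_r) : AxisymmetricTypeIExclusion := by
  intro u p hsol hu3 hp haxi hI
  rw [ssCylinderOpens_eq_parCylOpens] at hsol
  rw [ssCylinder_eq_parCyl] at hu3 hp hI
  have hloc : IsAxisymmetricLocalSolution u p := ⟨hsol, hu3, hp, haxi⟩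
  exact exists_eLpNorm_parabolicCylinder_lt_top_of_isRegularAtOrigin
    (isRegularAtOrigin_of_typeI' h35 h37 h4 h53 hloc hI)

/-- **`AxisymmetricTypeIExclusion` from the current leaves of the printed architecture**:
Lemma 3.5 (`ScaledEnergyBound`), the off-axis bound behind Prop. 3.7 (`OffAxisBound`,
Seregin–Šverák p. 10 after (as15) = Seregin–Zajaczkowski 2007, Prop. 4.1; Prop. 3.7 itself is
then PROVED, `SereginSverak2009.axisDecayBound_of_offAxisBound`), the Type I blow-up step
(`BlowupAlternativeTypeI`) and KNSS 2009, Thm. 5.3. Discharging these four named facts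
discharges the barrier. [cite: SereginSverak2009, Thm. 3.1, Prop. 3.7 and §4] -/
theorem axisymmetricTypeIExclusion_of_leaves (h35 : ScaledEnergyBound) (hoff : OffAxisBound)
    (h4 : BlowupAlternativeTypeI) (h53 : KNSS2009_liouville_bound_C_over_r) :
    AxisymmetricTypeIExclusion :=
  axisymmetricTypeIExclusion_of_blowupAlternativeTypeI h35 (axisDecayBound_of_offAxisBound h35 hoff)
    h4 h53

/-! ### The barrier from the three named facts that remain (third reduction) -/

/-- **Seregin–Šverák 2009, Proposition 3.7, from the off-axis bound alone**: with Lemma 3.5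
discharged (`ScaledEnergyBound_holds`), the axis decay bound `|x'| |v| ≤ C₁` a.e. on `Q(1/8)`
(`AxisDecayBound`) follows from `OffAxisBound` by the printed assembly
`axisDecayBound_of_offAxisBound`. [cite: SereginSverak2009, Prop. 3.7 and its proof (arXiv p. 10)] -/
theorem axisDecayBound_of_offAxisBound' (hoff : OffAxisBound) : AxisDecayBound :=
  axisDecayBound_of_offAxisBound ScaledEnergyBound_holds hoff

/-- **`AxisymmetricTypeIExclusion` from the three named facts that remain.** With Lemma 3.5
(`ScaledEnergyBound_holds`) and the interior-continuity input of §4 (`InteriorContinuity_holds`)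
discharged, Seregin–Šverák 2009, Thm. 3.1 (= Thm. 1.1) in the barrier's phrasing follows from the
off-axis bound behind Prop. 3.7 (`OffAxisBound`: the display after (as15), arXiv p. 10, =
Seregin–Zajaczkowski 2007, Prop. 4.1 rescaled), the uniform local Hölder bound of the blow-up
sequence (`LocalHolderBound`: (p12) and the estimates following it, [LSU] and the local regularity
theory of the Stokes system [S8]) and the Liouville theorem KNSS 2009, Thm. 5.3
(`KNSS2009_liouville_bound_C_over_r`), through `axisymmetricTypeIExclusion_of_leaves`,
`blowupAlternativeTypeI_of_localHolderBound` and the proved interior continuity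
`interiorContinuity_of NSBoundedInteriorContinuity_holds` (= `InteriorContinuity_holds`).
Discharging these three named facts discharges the barrier: `AxisymmetricTypeIExclusion_holds`
will be this theorem applied to their `_holds`.
[cite: SereginSverak2009, Thm. 3.1 (p. 9), Prop. 3.7 (p. 10) and §4 (p. 11)] -/
theorem axisymmetricTypeIExclusion_of_offAxisBound_of_localHolderBound (hoff : OffAxisBound)
    (hLHB : LocalHolderBound) (h53 : KNSS2009_liouville_bound_C_over_r) :
    AxisymmetricTypeIExclusion :=
  axisymmetricTypeIExclusion_of_leaves ScaledEnergyBound_holds hoff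
    (blowupAlternativeTypeI_of_localHolderBound
      (interiorContinuity_of NSBoundedInteriorContinuity_holds) hLHB) h53

/-- The non-existence form (KNSS 2009, §1: axisymmetric singularities are of Type II) from the
same three named facts: no axisymmetric distributional solution in the unit cylinder with
`u ∈ L³(Q)`, `p ∈ L^{3/2}(Q)`, the Type I bound and a singular origin.
[cite: SereginSverak2009, Thm. 3.1 (= Thm. 1.1) and §1] -/
theorem no_typeI_singularity_of_offAxisBound_of_localHolderBound (hoff : OffAxisBound)
    (hLHB : LocalHolderBound) (h53 : KNSS2009_liouville_bound_C_over_r) :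
    ¬ ∃ (u : ℝ → EuclideanSpace ℝ (Fin 3) → EuclideanSpace ℝ (Fin 3))
        (p : ℝ → EuclideanSpace ℝ (Fin 3) → ℝ),
      IsDistributionalNSSolutionOn ssCylinderOpens 1 0 u p ∧
      (∫⁻ z in ssCylinder, ‖u z.1 z.2‖ₑ ^ (3 : ℕ) < ∞) ∧
      (∫⁻ z in ssCylinder, ‖p z.1 z.2‖ₑ ^ (3 / 2 : ℝ) < ∞) ∧
      (∀ t ∈ Ioo (-1 : ℝ) 0, IsAxisymmetric (u t)) ∧
      (∃ C : ℝ, ∀ᵐ z ∂(volume.restrict ssCylinder), Real.sqrt (-z.1) * ‖u z.1 z.2‖ ≤ C) ∧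
      ∀ r > 0, eLpNorm (uncurry u) ∞ (volume.restrict (parabolicCylinder r (0, 0))) = ∞ :=
  (axisymmetricTypeIExclusion_of_offAxisBound_of_localHolderBound hoff hLHB h53).no_typeI_singularity

end Literature.Barriers.NavierStokesRegularity
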